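import Summits.KontsevichZagierPeriods.KontsevichZagierPeriods.Theses.FurushoPentagon
import Literature.NumberTheory.Transcendental.KZCalculusProofs
import Literature.NumberTheory.Transcendental.KZUnfolding
import Literature.NumberTheory.Transcendental.SemialgebraicMapsProofs
import Literature.NumberTheory.Transcendental.MultipleZeta

/-!
# drefute — `stub_descents` of line `dilation-homotopy-transposition` (crux stmt-KontsevichZagierPeriods-3930)

The two Newton–Leibniz descents of the peak (KZ rule 3 along the dilation variable `λ`), with the
null-face bookkeeping that closes the open peak domain into the literal band of
`KZ.newtonLeibnizRel`.  `peak_descent` is the common engine; `stub_descents_proof` has VERBATIM the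
type of the lead's `stub_descents` (Lines/dilation-homotopy-transposition.lean).
-/

noncomputable section
set_option linter.dupNamespace false
open Set MeasureTheory MvPolynomial
open Literature.NumberTheory.Transcendental
open Literature.ModelTheory.ExponentialFields (IsSemialgebraic)

namespace Summit.KontsevichZagierPeriods.KontsevichZagierPeriods.Cruxes.HoffmanRelationInKZ.Drefute

variable {m : ℕ}

/-- The closed band `{(y, λ) | y ∈ σ, a y ≤ λ ≤ 1}`. -/
def bandSet (σ : Set (Fin (m + 1) → ℝ)) (a : (Fin (m + 1) → ℝ) → ℝ) : Set (Fin (m + 2) → ℝ) :=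
  {z | (Fin.init z : Fin (m + 1) → ℝ) ∈ σ ∧ a (Fin.init z) ≤ z (Fin.last (m + 1)) ∧ z (Fin.last (m + 1)) ≤ 1}

/-- Its two faces `λ = a y` and `λ = 1`. -/
def faceSet (σ : Set (Fin (m + 1) → ℝ)) (a : (Fin (m + 1) → ℝ) → ℝ) : Set (Fin (m + 2) → ℝ) :=
  {z | (Fin.init z : Fin (m + 1) → ℝ) ∈ σ ∧ (z (Fin.last (m + 1)) = a (Fin.init z) ∨ z (Fin.last (m + 1)) = 1)}

theorem volume_setOf_last_eq_one : volume {z : Fin (m + 2) → ℝ | z (Fin.last (m + 1)) = 1} = 0 := by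
  rw [volume_pi]
  exact Measure.pi_hyperplane _ _ _

theorem volume_setOf_last_eq_zero : volume {z : Fin (m + 2) → ℝ | z (Fin.last (m + 1)) = 0} = 0 := by
  rw [volume_pi]
  exact Measure.pi_hyperplane _ _ _

/-- The diagonal hyperplane `{λ = u}` is null (a proper linear subspace). -/
theorem volume_setOf_last_eq_zero_coord : volume {z : Fin (m + 2) → ℝ | z (Fin.last (m + 1)) = z 0} = 0 := by
  let L : (Fin (m + 2) → ℝ) →ₗ[ℝ] ℝ :=
    LinearMap.proj (R := ℝ) (φ := fun _ : Fin (m + 2) => ℝ) (Fin.last (m + 1)) -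
      LinearMap.proj (R := ℝ) (φ := fun _ : Fin (m + 2) => ℝ) 0
  have hker : {z : Fin (m + 2) → ℝ | z (Fin.last (m + 1)) = z 0} = (LinearMap.ker L : Set _) := by
    ext z
    simp [L, sub_eq_zero]
  have hne : LinearMap.ker L ≠ ⊤ := by
    intro h
    have hmem : (Pi.single (Fin.last (m + 1)) (1 : ℝ) : Fin (m + 2) → ℝ) ∈ LinearMap.ker L := by
      rw [h]; exact Submodule.mem_top
    have h0 : (Fin.last (m + 1) : Fin (m + 2)) ≠ 0 := by
      intro h'; have := congrArg Fin.val h'; simp at this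
    simp [L, h0.symm] at hmem
  rw [hker]
  exact Measure.addHaar_submodule volume _ hne

/-- **Engine.** One Newton–Leibniz descent of an open peak `R` over the base `r`, lower edge `a`,
upper edge `1`: the open peak domain is closed by adding the two null faces (domain additivity +
`KZ.of_mem_levelRel_of_volume_eq_zero`), then rule 3) is applied with primitive `F`. -/
theorem peak_descent (r : KZ.IntegralRep (m + 1)) (R : KZ.IntegralRep (m + 2))
    (a : (Fin (m + 1) → ℝ) → ℝ) (Φ F : (Fin (m + 2) → ℝ) → ℝ)
    (ha : IsSemialgebraicFunOn ℚ r.domain a)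
    (ha01 : ∀ y ∈ r.domain, 0 ≤ a y ∧ a y < 1)
    (hband : IsSemialgebraic ℚ (bandSet r.domain a))
    (hfaces : IsSemialgebraic ℚ (faceSet r.domain a))
    (hnull : volume (faceSet r.domain a) = 0)
    (hRdom : R.domain = {z | (Fin.init z : Fin (m + 1) → ℝ) ∈ r.domain ∧
      a (Fin.init z) < z (Fin.last (m + 1)) ∧ z (Fin.last (m + 1)) < 1})
    (hRint : EqOn R.integrand Φ R.domain)
    (hΦ : IsSemialgebraicFunOn ℚ (bandSet r.domain a) Φ)
    (hF : IsSemialgebraicFunOn ℚ (bandSet r.domain a) F)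
    (hcont : ∀ y ∈ r.domain, ContinuousOn (fun t : ℝ => F (Fin.snoc y t)) (Icc (a y) 1))
    (hderiv : ∀ y ∈ r.domain, ∀ t ∈ Ioo (a y) 1,
      HasDerivAt (fun t : ℝ => F (Fin.snoc y t)) (Φ (Fin.snoc y t)) t)
    (hbd : ∀ y ∈ r.domain, r.integrand y = F (Fin.snoc y 1) - F (Fin.snoc y (a y))) :
    KZ.of R - KZ.of r ∈ KZ.relations := by
  -- the band is the open peak plus the two faces
  have hunion : bandSet r.domain a = R.domain ∪ faceSet r.domain a := by
    ext z
    rw [hRdom]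
    simp only [bandSet, faceSet, mem_setOf_eq, mem_union]
    constructor
    · rintro ⟨hy, h1, h2⟩
      rcases h1.lt_or_eq with h1 | h1
      · rcases h2.lt_or_eq with h2 | h2
        · exact Or.inl ⟨hy, h1, h2⟩
        · exact Or.inr ⟨hy, Or.inr h2⟩
      · exact Or.inr ⟨hy, Or.inl h1.symm⟩
    · rintro (⟨hy, h1, h2⟩ | ⟨hy, h | h⟩)
      · exact ⟨hy, h1.le, h2.le⟩
      · exact ⟨hy, h.symm.le, by rw [h]; exact (ha01 _ hy).2.le⟩
      · exact ⟨hy, by rw [h]; exact (ha01 _ hy).2.le, h.le⟩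
  have hfaces_sub : faceSet r.domain a ⊆ bandSet r.domain a := by
    rw [hunion]; exact subset_union_right
  have hΦint_R : IntegrableOn Φ R.domain :=
    R.integrableOn.congr_fun hRint (KZ.IntegralRep.measurableSet_domain_holds R)
  have hΦint_faces : IntegrableOn Φ (faceSet r.domain a) := by
    rw [IntegrableOn, Measure.restrict_eq_zero.mpr hnull]
    exact integrable_zero_measure
  -- the closed band representation and the face representation
  let Rb : KZ.IntegralRep (m + 2) :=
    { domain := bandSet r.domain a
      integrand := Φ
      isSemialgebraic_domain := hband
      isSemialgebraicFunOn_integrand := hΦ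
      integrableOn := by rw [hunion]; exact hΦint_R.union hΦint_faces }
  let Fc : KZ.IntegralRep (m + 2) :=
    { domain := faceSet r.domain a
      integrand := Φ
      isSemialgebraic_domain := hfaces
      isSemialgebraicFunOn_integrand := hΦ.mono hfaces_sub hfaces
      integrableOn := hΦint_faces }
  -- (1a) domain additivity: [Rb] − [R] − [Fc]
  have hadd : KZ.of Rb - KZ.of R - KZ.of Fc ∈ KZ.relations := by
    refine KZ.domainAddRel_subset_relations ⟨m + 2, Rb, R, Fc, hunion, ?_, hRint.symm, fun _ _ => rfl, rfl⟩
    exact measure_mono_null inter_subset_right hnull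
  -- the faces are junk
  have hFc : KZ.of Fc ∈ KZ.relations :=
    KZ.levelRel_le_relations (KZ.of_mem_levelRel_of_volume_eq_zero Fc hnull)
  -- (3) Newton–Leibniz on the closed band
  have hNL : KZ.of Rb - KZ.of r ∈ KZ.relations := by
    refine KZ.newtonLeibnizRel_subset_relations
      ⟨m + 1, Rb, r, a, fun _ => 1, F, hF, ha, ?_, fun y hy => (ha01 y hy).2.le, rfl, hcont, ?_, hbd, rfl⟩
    · exact (isSemialgebraicFunOn_aeval r.isSemialgebraic_domain 1).congr fun x _ => by simp
    · intro y hy t ht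
      exact hderiv y hy t ht
  have key : KZ.of R - KZ.of r = (KZ.of Rb - KZ.of r) - (KZ.of Rb - KZ.of R - KZ.of Fc) - KZ.of Fc := by
    abel
  rw [key]
  exact KZ.relations.sub_mem (KZ.relations.sub_mem hNL hadd) hFc

/-! ### Coordinate helpers on `Fin (n+1) → ℝ` / `Fin (n+2) → ℝ` -/

variable {n : ℕ}

theorem castSucc_zero' : ((0 : Fin (n + 1)).castSucc : Fin (n + 2)) = 0 := by
  ext; simp

theorem castSucc_one' (hn : 1 ≤ n) : ((1 : Fin (n + 1)).castSucc : Fin (n + 2)) = 1 := by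
  ext
  simp only [Fin.val_castSucc, Fin.val_one', Nat.mod_eq_of_lt (by omega : 1 < n + 1),
    Nat.mod_eq_of_lt (by omega : 1 < n + 2)]

@[simp] theorem snoc_zero'' (y : Fin (n + 1) → ℝ) (t : ℝ) :
    (Fin.snoc y t : Fin (n + 2) → ℝ) 0 = y 0 := by
  rw [← castSucc_zero', Fin.snoc_castSucc]

@[simp] theorem init_zero'' (z : Fin (n + 2) → ℝ) : Fin.init z (0 : Fin (n + 1)) = z 0 := by
  rw [Fin.init, castSucc_zero']

theorem init_one'' (hn : 1 ≤ n) (z : Fin (n + 2) → ℝ) : Fin.init z (1 : Fin (n + 1)) = z 1 := by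
  rw [Fin.init, castSucc_one' hn]

/-- `σ 1 = id`, `σ` the shear of the corner coordinate. -/
theorem shear_one (σ : ℝ → (Fin n → ℝ) → (Fin n → ℝ))
    (hσ : ∀ (c : ℝ) (x : Fin n → ℝ) (j : Fin n), σ c x j = if (j : ℕ) = 0 then c * x j else x j)
    (x : Fin n → ℝ) : σ 1 x = x := by
  funext j; rw [hσ]; split_ifs <;> simp

/-! ### The two descents for the lead's data `(f, K, σ)` -/

section Data

variable (f : (Fin n → ℝ) → ℝ) (K : (Fin n → ℝ) → ℝ) (σ : ℝ → (Fin n → ℝ) → (Fin n → ℝ))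

/-- The peak integrand `K(σ_λ x)/(1 − u)` and its primitive `λ f(σ_λ x)/(1 − u)` in the
coordinates `z = (u, x, λ)`. -/
def peakΦ (z : Fin (n + 2) → ℝ) : ℝ := K (σ (z (Fin.last (n + 1))) (Fin.tail (Fin.init z))) / (1 - z 0)
def peakF (z : Fin (n + 2) → ℝ) : ℝ :=
  z (Fin.last (n + 1)) * f (σ (z (Fin.last (n + 1))) (Fin.tail (Fin.init z))) / (1 - z 0)

omit K in
theorem peakF_snoc (y : Fin (n + 1) → ℝ) (t : ℝ) :
    peakF f σ (Fin.snoc y t) = t * f (σ t (Fin.tail y)) / (1 - y 0) := by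
  simp [peakF]

omit f in
theorem peakΦ_snoc (y : Fin (n + 1) → ℝ) (t : ℝ) :
    peakΦ K σ (Fin.snoc y t) = K (σ t (Fin.tail y)) / (1 - y 0) := by
  simp [peakΦ]

/-- The big band `{(u,x) ∈ (0,1)ⁿ⁺¹, 0 ≤ λ ≤ 1}` of the dilation-calculus stub. -/
def bigBand (n : ℕ) : Set (Fin (n + 2) → ℝ) :=
  {z | (∀ i, Fin.init z i ∈ Ioo (0:ℝ) 1) ∧ 0 ≤ z (Fin.last (n + 1)) ∧ z (Fin.last (n + 1)) ≤ 1}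

/-- **Descent (B)**: peak `{u < λ}` minus the stuffle side. -/
theorem descentB
    (hσ : ∀ (c : ℝ) (x : Fin n → ℝ) (j : Fin n), σ c x j = if (j : ℕ) = 0 then c * x j else x j)
    (hder : ∀ x : Fin n → ℝ, (∀ i, x i ∈ Ioo (0:ℝ) 1) → ∀ l ∈ Ioo (0:ℝ) 1,
      HasDerivAt (fun l : ℝ => l * f (σ l x)) (K (σ l x)) l)
    (hcontF : ∀ x : Fin n → ℝ, (∀ i, x i ∈ Ioo (0:ℝ) 1) → ContinuousOn (fun l : ℝ => l * f (σ l x)) (Icc 0 1))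
    (hsaK : IsSemialgebraicFunOn ℚ (bigBand n) (peakΦ K σ))
    (hsaF : IsSemialgebraicFunOn ℚ (bigBand n) (peakF f σ))
    (r : KZ.IntegralRep (n + 1)) (R : KZ.IntegralRep (n + 2))
    (hr : r.domain = {y | ∀ i, y i ∈ Ioo (0:ℝ) 1} ∧
      EqOn r.integrand (fun y => (f (Fin.tail y) - y 0 * f (σ (y 0) (Fin.tail y))) / (1 - y 0)) r.domain)
    (hR : R.domain = {z | (∀ i, z i ∈ Ioo (0:ℝ) 1) ∧ z 0 < z (Fin.last (n + 1))} ∧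
      EqOn R.integrand (peakΦ K σ) R.domain) :
    KZ.of R - KZ.of r ∈ KZ.relations := by
  have hsub : bandSet r.domain (fun y => y 0) ⊆ bigBand n := by
    intro z hz
    rw [bandSet, hr.1] at hz
    obtain ⟨hy, h1, h2⟩ := hz
    exact ⟨hy, (by simpa using (hy 0).1.le : (0:ℝ) ≤ Fin.init z 0).trans h1, h2⟩
  have hband : IsSemialgebraic ℚ (bandSet r.domain (fun y : Fin (n + 1) → ℝ => y 0)) := by
    have h1 := Literature.ModelTheory.ExponentialFields.isSemialgebraic_setOf_eval_le (k := ℚ) (R := ℝ)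
      (X ((0 : Fin (n + 1)).castSucc) : MvPolynomial (Fin (n + 2)) ℚ) (X (Fin.last (n + 1)))
    have h2 := Literature.ModelTheory.ExponentialFields.isSemialgebraic_setOf_eval_le (k := ℚ) (R := ℝ)
      (X (Fin.last (n + 1)) : MvPolynomial (Fin (n + 2)) ℚ) 1
    convert (r.isSemialgebraic_domain.setOf_init_mem.inter h1).inter h2 using 1
    ext z
    simp only [bandSet, mem_setOf_eq, mem_inter_iff, aeval_X, map_one, Fin.init, and_assoc]
  have hfaces : IsSemialgebraic ℚ (faceSet r.domain (fun y : Fin (n + 1) → ℝ => y 0)) := by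
    have h1 := Literature.ModelTheory.ExponentialFields.isSemialgebraic_setOf_eval_eq_zero (k := ℚ) (R := ℝ)
      (X (Fin.last (n + 1)) - X ((0 : Fin (n + 1)).castSucc) : MvPolynomial (Fin (n + 2)) ℚ)
    have h2 := Literature.ModelTheory.ExponentialFields.isSemialgebraic_setOf_eval_eq_zero (k := ℚ) (R := ℝ)
      (X (Fin.last (n + 1)) - 1 : MvPolynomial (Fin (n + 2)) ℚ)
    convert r.isSemialgebraic_domain.setOf_init_mem.inter (h1.union h2) using 1
    ext z
    simp only [faceSet, mem_setOf_eq, mem_inter_iff, mem_union, map_sub, aeval_X, map_one, sub_eq_zero,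
      Fin.init]
  have hnull : volume (faceSet r.domain (fun y : Fin (n + 1) → ℝ => y 0)) = 0 := by
    refine measure_mono_null ?_ (measure_union_null volume_setOf_last_eq_zero_coord volume_setOf_last_eq_one)
    rintro z ⟨-, h | h⟩
    · exact Or.inl (by simpa using h)
    · exact Or.inr h
  refine peak_descent r R (fun y => y 0) (peakΦ K σ) (peakF f σ) ?_ ?_ hband hfaces hnull ?_ hR.2
    (hsaK.mono hsub hband) (hsaF.mono hsub hband) ?_ ?_ ?_
  · exact (isSemialgebraicFunOn_aeval r.isSemialgebraic_domain (X 0)).congr fun x _ => by simp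
  · intro y hy; rw [hr.1] at hy; exact ⟨(hy 0).1.le, (hy 0).2⟩
  · rw [hR.1, hr.1]
    ext z
    simp only [mem_setOf_eq, init_zero'']
    constructor
    · rintro ⟨hz, hlt⟩
      exact ⟨fun i => hz i.castSucc, hlt, (hz (Fin.last _)).2⟩
    · rintro ⟨hz, h1, h2⟩
      refine ⟨fun i => ?_, h1⟩
      refine Fin.lastCases ?_ (fun j => ?_) i
      · exact ⟨(hz 0).1.trans (by simpa using h1), h2⟩
      · exact hz j
  · intro y hy
    rw [hr.1] at hy
    have htail : ∀ i, Fin.tail y i ∈ Ioo (0:ℝ) 1 := fun i => hy i.succ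
    have h := ((hcontF _ htail).mono (Icc_subset_Icc (hy 0).1.le le_rfl)).div_const (1 - y 0)
    refine h.congr fun t _ => ?_
    rw [peakF_snoc]
  · intro y hy t ht
    rw [hr.1] at hy
    have htail : ∀ i, Fin.tail y i ∈ Ioo (0:ℝ) 1 := fun i => hy i.succ
    have ht' : t ∈ Ioo (0:ℝ) 1 := ⟨(hy 0).1.trans ht.1, ht.2⟩
    have h := (hder _ htail t ht').div_const (1 - y 0)
    have hfun : (fun t : ℝ => peakF f σ (Fin.snoc y t)) = fun t => t * f (σ t (Fin.tail y)) / (1 - y 0) := by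
      funext t; rw [peakF_snoc]
    rw [hfun, peakΦ_snoc]
    exact h
  · intro y hy
    rw [hr.2 hy, peakF_snoc, peakF_snoc, shear_one σ hσ, one_mul]
    ring

/-- **Descent (A)**: transposed peak `{u < x₀}` minus the shuffle side. -/
theorem descentA (hn : 1 ≤ n)
    (hσ : ∀ (c : ℝ) (x : Fin n → ℝ) (j : Fin n), σ c x j = if (j : ℕ) = 0 then c * x j else x j)
    (hder : ∀ x : Fin n → ℝ, (∀ i, x i ∈ Ioo (0:ℝ) 1) → ∀ l ∈ Ioo (0:ℝ) 1,
      HasDerivAt (fun l : ℝ => l * f (σ l x)) (K (σ l x)) l)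
    (hcontF : ∀ x : Fin n → ℝ, (∀ i, x i ∈ Ioo (0:ℝ) 1) → ContinuousOn (fun l : ℝ => l * f (σ l x)) (Icc 0 1))
    (hsaK : IsSemialgebraicFunOn ℚ (bigBand n) (peakΦ K σ))
    (hsaF : IsSemialgebraicFunOn ℚ (bigBand n) (peakF f σ))
    (r : KZ.IntegralRep (n + 1)) (R : KZ.IntegralRep (n + 2))
    (hr : r.domain = {y | (∀ i, y i ∈ Ioo (0:ℝ) 1) ∧ y 0 < y 1} ∧
      EqOn r.integrand (fun y => f (Fin.tail y) / (1 - y 0)) r.domain)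
    (hR : R.domain = {z | (∀ i, z i ∈ Ioo (0:ℝ) 1) ∧ z 0 < z 1} ∧
      EqOn R.integrand (peakΦ K σ) R.domain) :
    KZ.of R - KZ.of r ∈ KZ.relations := by
  have hsub : bandSet r.domain (fun _ => (0:ℝ)) ⊆ bigBand n := by
    intro z hz
    rw [bandSet, hr.1] at hz
    obtain ⟨hy, h1, h2⟩ := hz
    exact ⟨hy.1, h1, h2⟩
  have hband : IsSemialgebraic ℚ (bandSet r.domain (fun _ : Fin (n + 1) → ℝ => (0:ℝ))) := by
    have h1 := Literature.ModelTheory.ExponentialFields.isSemialgebraic_setOf_eval_le (k := ℚ) (R := ℝ)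
      (0 : MvPolynomial (Fin (n + 2)) ℚ) (X (Fin.last (n + 1)))
    have h2 := Literature.ModelTheory.ExponentialFields.isSemialgebraic_setOf_eval_le (k := ℚ) (R := ℝ)
      (X (Fin.last (n + 1)) : MvPolynomial (Fin (n + 2)) ℚ) 1
    convert (r.isSemialgebraic_domain.setOf_init_mem.inter h1).inter h2 using 1
    ext z
    simp only [bandSet, mem_setOf_eq, mem_inter_iff, aeval_X, map_one, map_zero, and_assoc]
  have hfaces : IsSemialgebraic ℚ (faceSet r.domain (fun _ : Fin (n + 1) → ℝ => (0:ℝ))) := by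
    have h1 := Literature.ModelTheory.ExponentialFields.isSemialgebraic_setOf_eval_eq_zero (k := ℚ) (R := ℝ)
      (X (Fin.last (n + 1)) : MvPolynomial (Fin (n + 2)) ℚ)
    have h2 := Literature.ModelTheory.ExponentialFields.isSemialgebraic_setOf_eval_eq_zero (k := ℚ) (R := ℝ)
      (X (Fin.last (n + 1)) - 1 : MvPolynomial (Fin (n + 2)) ℚ)
    convert r.isSemialgebraic_domain.setOf_init_mem.inter (h1.union h2) using 1
    ext z
    simp only [faceSet, mem_setOf_eq, mem_inter_iff, mem_union, map_sub, aeval_X, map_one, sub_eq_zero]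
  have hnull : volume (faceSet r.domain (fun _ : Fin (n + 1) → ℝ => (0:ℝ))) = 0 := by
    refine measure_mono_null ?_ (measure_union_null volume_setOf_last_eq_zero volume_setOf_last_eq_one)
    rintro z ⟨-, h | h⟩
    · exact Or.inl h
    · exact Or.inr h
  refine peak_descent r R (fun _ => 0) (peakΦ K σ) (peakF f σ) ?_ (fun _ _ => ⟨le_rfl, one_pos⟩)
    hband hfaces hnull ?_ hR.2 (hsaK.mono hsub hband) (hsaF.mono hsub hband) ?_ ?_ ?_
  · exact (isSemialgebraicFunOn_aeval r.isSemialgebraic_domain 0).congr fun x _ => by simp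
  · rw [hR.1, hr.1]
    ext z
    simp only [mem_setOf_eq, init_zero'', init_one'' hn]
    constructor
    · rintro ⟨hz, hlt⟩
      exact ⟨⟨fun i => hz i.castSucc, hlt⟩, (hz (Fin.last _)).1, (hz (Fin.last _)).2⟩
    · rintro ⟨⟨hz, hlt⟩, h1, h2⟩
      refine ⟨fun i => ?_, hlt⟩
      refine Fin.lastCases ?_ (fun j => ?_) i
      · exact ⟨h1, h2⟩
      · exact hz j
  · intro y hy
    rw [hr.1] at hy
    have htail : ∀ i, Fin.tail y i ∈ Ioo (0:ℝ) 1 := fun i => hy.1 i.succ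
    have h := (hcontF _ htail).div_const (1 - y 0)
    refine h.congr fun t _ => ?_
    rw [peakF_snoc]
  · intro y hy t ht
    rw [hr.1] at hy
    have htail : ∀ i, Fin.tail y i ∈ Ioo (0:ℝ) 1 := fun i => hy.1 i.succ
    have h := (hder _ htail t ht).div_const (1 - y 0)
    have hfun : (fun t : ℝ => peakF f σ (Fin.snoc y t)) = fun t => t * f (σ t (Fin.tail y)) / (1 - y 0) := by
      funext t; rw [peakF_snoc]
    rw [hfun, peakΦ_snoc]
    exact h
  · intro y hy
    rw [hr.2 hy, peakF_snoc, peakF_snoc, shear_one σ hσ, one_mul, zero_mul, zero_div, sub_zero]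

end Data

/-- Admissible non-empty indices have weight `≥ 2`. -/
theorem two_le_weight {s : List ℕ} (hs : MZV.IsAdmissible s) (hne : s ≠ []) : 2 ≤ MZV.weight s := by
  obtain ⟨a, t, rfl⟩ := List.exists_cons_of_ne_nil hne
  have ha : 2 ≤ a := hs.2 (List.cons_ne_nil a t)
  simp only [MZV.weight, List.sum_cons]
  omega

/-- **`stub_descents` of the lead's skeleton, PROVED** (type copied verbatim). -/
theorem stub_descents_proof : ∀ (s : List ℕ), MZV.IsAdmissible s → s ≠ [] → ∀ (f : (Fin (MZV.weight s) → ℝ) → ℝ) (K : (Fin (MZV.weight s) → ℝ) → ℝ) (σ : ℝ → (Fin (MZV.weight s) → ℝ) → (Fin (MZV.weight s) → ℝ)), (∀ (c : ℝ) (x : Fin (MZV.weight s) → ℝ) (j : Fin (MZV.weight s)), σ c x j = if (j : ℕ) = 0 then c * x j else x j) → ((∀ x : Fin (MZV.weight s) → ℝ, (∀ i, x i ∈ Set.Ioo (0:ℝ) 1) → ∀ l ∈ Set.Ioo (0:ℝ) 1, HasDerivAt (fun l : ℝ => l * f (σ l x)) (K (σ l x)) l) ∧ (∀ x : Fin (MZV.weight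 s) → ℝ, (∀ i, x i ∈ Set.Ioo (0:ℝ) 1) → ContinuousOn (fun l : ℝ => l * f (σ l x)) (Set.Icc 0 1)) ∧ (∀ x : Fin (MZV.weight s) → ℝ, (∀ i, x i ∈ Set.Ioo (0:ℝ) 1) → ContinuousOn (fun l : ℝ => K (σ l x)) (Set.Icc 0 1)) ∧ (∀ x : Fin (MZV.weight s) → ℝ, (∀ i, x i ∈ Set.Ioo (0:ℝ) 1) → ∀ l ∈ Set.Icc (0:ℝ) 1, 0 ≤ K (σ l x)) ∧ IsSemialgebraicFunOn ℚ {z : Fin (MZV.weight s + 2) → ℝ | (∀ i, Fin.init z i ∈ Set.Ioo (0:ℝ) 1) ∧ 0 ≤ z (Fin.last (MZV.weight s + 1)) ∧ z (Fin.last (MZV.weight s + 1)) ≤ 1} (fun z => K (σ (z (Fin.last (MZV.weight s + 1))) (Fin.tail (Fin.init z))) / (1 - z 0)) ∧ IsSemialgebraicFunOn ℚ {z : Fin (MZV.weight s + 2) → ℝ | (∀ i, Fin.init z i ∈ Set.Ioo (0:ℝ) 1) ∧ 0 ≤ z (Fin.last (MZV.weight s + 1)) ∧ z (Fin.last (MZV.weight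 s + 1)) ≤ 1} (fun z => z (Fin.last (MZV.weight s + 1)) * f (σ (z (Fin.last (MZV.weight s + 1))) (Fin.tail (Fin.init z))) / (1 - z 0))) → (∀ (r : KZ.IntegralRep (MZV.weight s + 1)) (R : KZ.IntegralRep (MZV.weight s + 2)), (r.domain = {y : Fin (MZV.weight s + 1) → ℝ | (∀ i, y i ∈ Set.Ioo (0:ℝ) 1) ∧ y 0 < y 1} ∧ Set.EqOn r.integrand (fun y => f (Fin.tail y) / (1 - y 0)) r.domain) → (R.domain = {z : Fin (MZV.weight s + 2) → ℝ | (∀ i, z i ∈ Set.Ioo (0:ℝ) 1) ∧ z 0 < z 1} ∧ Set.EqOn R.integrand (fun z => K (σ (z (Fin.last (MZV.weight s + 1))) (Fin.tail (Fin.init z))) / (1 - z 0)) R.domain) → KZ.of R - KZ.of r ∈ KZ.relations) ∧ (∀ (r : KZ.IntegralRep (MZV.weight s + 1)) (R : KZ.IntegralRep (MZV.weight s + 2)), (r.domain = {y : Fin (MZV.weight s + 1) → ℝ | ∀ i, y i ∈ Set.Ioo (0:ℝ) 1} ∧ Set.EqOn r.integrand (fun y => (f (Fin.tail y) - y 0 *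 f (σ (y 0) (Fin.tail y))) / (1 - y 0)) r.domain) → (R.domain = {z : Fin (MZV.weight s + 2) → ℝ | (∀ i, z i ∈ Set.Ioo (0:ℝ) 1) ∧ z 0 < z (Fin.last (MZV.weight s + 1))} ∧ Set.EqOn R.integrand (fun z => K (σ (z (Fin.last (MZV.weight s + 1))) (Fin.tail (Fin.init z))) / (1 - z 0)) R.domain) → KZ.of R - KZ.of r ∈ KZ.relations) := by
  intro s hs hne f K σ hσ hcalc
  obtain ⟨hder, hcontF, -, -, hsaK, hsaF⟩ := hcalc
  have hn : 1 ≤ MZV.weight s := by have := two_le_weight hs hne; omega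
  exact ⟨fun r R hr hR => descentA f K σ hn hσ hder hcontF hsaK hsaF r R hr hR,
    fun r R hr hR => descentB f K σ hσ hder hcontF hsaK hsaF r R hr hR⟩

end Summit.KontsevichZagierPeriods.KontsevichZagierPeriods.Cruxes.HoffmanRelationInKZ.Drefute
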